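import Summits.QuantumFields.YangMills.Theorems.IR.AfPincerUcXCovPincer
import Summits.QuantumFields.YangMills.Theorems.IR.AfPincerUcSharpOnset

/-!
# Crux `IR` (stmt-QuantumFields-19354), line `af-pincer`, stub `stub_afOnsetUc : AFToOnsetUKPc` (X-side):
# the covariance reduction IN THE SLOT'S SHARP-ONSET CURRENCY — `I♯_SC` and the route decl BY NAME, with no X-stub

Fourth file of `Theorems/IR/AfPincerUcXCov{,Compact,Pincer,Sharp}` (seat ym-19354-afpincer-s2, generation 2), written after
`Theorems/IR/AfPincerUcSharpOnset` (onsetsc-p2, cplan port rev 2 71577857bd55b2bd: `SharpOnset.OnsetSharpUKPcSC` = I♯_SC,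
`SharpOnset.IRNSC`, `SharpOnset.ir_of_onsetSharpSC` with E discharged by p524017 `stub_typCriterionUc`) and
`Theorems/IR/Negative/AfOnsetUcFalseOfLateOnset` (cdisprove-afonset, owner R100: `KSMInf → ¬AFToOnsetUKPc` is the kill-world
hook of record) landed.

* §6 `ir_of_typCriterion_formatAtScale_covarianceAF` — `BalabanLadder.IR` BY NAME from E (hypothesis form) and, per `(G, r)`,
  one admissible `(n, ε)` and one scale `ℓ` carrying the format at mesh `≤ B(δ)·ℓ(β)` for every `δ > 0`, the crossover
  envelope and the asymptotic-freedom window (cplan's `ir_of_sharpOnset` in covariance clothes); `ir_of_formatAtScale_covarianceAF`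
  — the same with E DISCHARGED by the tree's `stub_typCriterionUc` (p524017).
* §7 **`onsetSharpUKPcSC_of_formatAtScale_covarianceAF`** — on the simply connected family the same per-`(G, r)` data give
  `SharpOnset.OnsetSharpUKPcSC` (I♯_SC) BY NAME: the onset is pinned at `a(β)·b < B·T` by the window + envelope
  (`afBelowScale_of_covarianceAF`) and the witness clause of `LowerBounds` (`scale_pinned_of_witness`);
  **`ir_of_formatAtScale_covarianceAF_of_irNSC`** — hence `BalabanLadder.IR` BY NAME from those data and the registered
  residual `stub_irNSC`-type hypothesis `SharpOnset.IRNSC`, with NO X-stub and E discharged (via `SharpOnset.ir_of_onsetSharpSC`).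

So, in the kernel: under the owner's candidate sharp re-cut (R96 (ii)), the S2 desk's whole contribution is the pair
(WINDOW at the LEAD's scale `ℓ`, ENVELOPE) — and the envelope only for non-compact NT witnesses (`…XCovCompact` §2,
`…XCovPincer`).  Nothing here is proved about Yang–Mills: every hypothesis is OPEN.

HONEST FRAMING.  Kernel compositions around one open stub of a CONDITIONAL chain (Track A 0/28 UV); not AF, not mixing,
not a gap, not Clay.
-/

set_option autoImplicit false

noncomputable section

open Filter Topology Finset MeasureTheory
open scoped BigOperators SchwartzMap
open Literature.MathematicalPhysics.QuantumFieldTheory hiding ZdEdge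
open Literature.MathematicalPhysics.QuantumLattice
open Literature.Probability.LatticeModels (Site box mem_box)
open Summit.QuantumFields.YangMills.Cruxes.OSLegsFromFemtoAndGap.DlrCollarTransfer
open Summit.QuantumFields.YangMills.Cruxes.IR.AfOnset

namespace Summit.QuantumFields.YangMills.Cruxes.IR.AfPincerUc

/-! ## §6 The route decl BY NAME from clustering, format-at-scale and the covariance hypotheses -/
section Route

/-- **`BalabanLadder.IR` BY NAME from E + «sharp onset with covariance-level asymptotic freedom»** (cplan g10's
`ir_of_sharpOnset` with `AFBelowScaleAt` discharged by `afBelowScale_of_covarianceAF`): the typical-data criterion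
`TypCriterionUKPc` together with, for every compact simple `G` and lattice representation `r`, ONE admissible `(n, ε)` and ONE
scale `ℓ` carrying (a) the format at a mesh `≤ B(δ)·ℓ(β)` for every `δ > 0` (the LEAD's mixing theorem in sharp form), (b) the
crossover envelope and (c) the asymptotic-freedom window at scale `ℓ`, imply the route decl.  The registered X-stub is not used.
[kernel composition; hypotheses OPEN] -/
theorem ir_of_typCriterion_formatAtScale_covarianceAF (hE : TypCriterionUKPc)
    (hsharp : ∀ (G : Type) [Group G] [TopologicalSpace G] [IsTopologicalGroup G] [CompactSpace G],
      IsCompactSimpleLieGroup G → letI : MeasurableSpace G := borel G; haveI : BorelSpace G := ⟨rfl⟩;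
      ∀ r : LatticeRep G, ∃ (n : ℕ) (ε : ℝ), 1 ≤ n ∧ 0 ≤ ε ∧ ε * OnsetFormats.shellCount n ≤ 3 / 4 ∧
        ∃ ℓ : ℝ → ℝ,
          (∀ δ : ℝ, 0 < δ → ∃ B β₂ : ℝ, 0 < B ∧ ∀ β : ℝ, β₂ ≤ β →
            ∃ b : ℕ, 1 ≤ b ∧ (b : ℝ) ≤ B * ℓ β ∧ TypShellCondUKPc r.ρ β b n ε δ) ∧
          (∃ W₀ β₀ : ℝ, ∀ β : ℝ, β₀ ≤ β → ∀ᶠ L : ℕ in atTop, ∀ x ∈ box 4 L, ∀ y ∈ box 4 L,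
            ‖x - y‖ ≤ (L : ℝ) →
              |torusE G r β L (fun U => dens G r x U * dens G r y U) -
                  torusE G r β L (dens G r x) * torusE G r β L (dens G r y)| ≤ W₀ / (1 + ‖x - y‖) ^ 8) ∧
          (∀ W : ℝ, 0 < W → ∃ T' β₀ : ℝ, 0 < T' ∧ ∀ β : ℝ, β₀ ≤ β → ∀ᶠ L : ℕ in atTop,
            ∀ x ∈ box 4 L, ∀ y ∈ box 4 L, ‖x - y‖ ≤ (L : ℝ) → T' * ‖x - y‖ ≤ ℓ β →
              |torusE G r β L (fun U => dens G r x U * dens G r y U) -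
                  torusE G r β L (dens G r x) * torusE G r β L (dens G r y)| ≤ W / (1 + ‖x - y‖) ^ 8)) :
    Summit.QuantumFields.YangMills.Theses.BalabanLadder.IR := by
  have h : IRCal := by
    intro G _ _ _ _ hG
    letI : MeasurableSpace G := borel G
    haveI : BorelSpace G := ⟨rfl⟩
    intro r a ha _ hlb
    obtain ⟨n, ε, hn, hε, hM, ℓ, hF, henv, haf⟩ := hsharp G hG r
    obtain ⟨δ₀, κ, s₀, hδ₀, hκ, hcl⟩ := fmtClustering_of_typCriterionUKPc hE r hn hε hM
    exact gapInUnits_of_envelope_window_format_clustering r a ℓ ha hκ hcl (hF δ₀ hδ₀) henv haf hlb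
  delta Summit.QuantumFields.YangMills.Theses.BalabanLadder.IR
  delta Summit.QuantumFields.YangMills.Cruxes.IR.AfPincerUc.IRCal at h
  exact h

/-- **The same with E DISCHARGED** by the tree's `stub_typCriterionUc` (S1, p524017): `BalabanLadder.IR` BY NAME from the
per-`(G, r)` sharp format + envelope + window alone. [kernel composition; hypotheses OPEN] -/
theorem ir_of_formatAtScale_covarianceAF
    (hsharp : ∀ (G : Type) [Group G] [TopologicalSpace G] [IsTopologicalGroup G] [CompactSpace G],
      IsCompactSimpleLieGroup G → letI : MeasurableSpace G := borel G; haveI : BorelSpace G := ⟨rfl⟩;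
      ∀ r : LatticeRep G, ∃ (n : ℕ) (ε : ℝ), 1 ≤ n ∧ 0 ≤ ε ∧ ε * OnsetFormats.shellCount n ≤ 3 / 4 ∧
        ∃ ℓ : ℝ → ℝ,
          (∀ δ : ℝ, 0 < δ → ∃ B β₂ : ℝ, 0 < B ∧ ∀ β : ℝ, β₂ ≤ β →
            ∃ b : ℕ, 1 ≤ b ∧ (b : ℝ) ≤ B * ℓ β ∧ TypShellCondUKPc r.ρ β b n ε δ) ∧
          (∃ W₀ β₀ : ℝ, ∀ β : ℝ, β₀ ≤ β → ∀ᶠ L : ℕ in atTop, ∀ x ∈ box 4 L, ∀ y ∈ box 4 L,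
            ‖x - y‖ ≤ (L : ℝ) →
              |torusE G r β L (fun U => dens G r x U * dens G r y U) -
                  torusE G r β L (dens G r x) * torusE G r β L (dens G r y)| ≤ W₀ / (1 + ‖x - y‖) ^ 8) ∧
          (∀ W : ℝ, 0 < W → ∃ T' β₀ : ℝ, 0 < T' ∧ ∀ β : ℝ, β₀ ≤ β → ∀ᶠ L : ℕ in atTop,
            ∀ x ∈ box 4 L, ∀ y ∈ box 4 L, ‖x - y‖ ≤ (L : ℝ) → T' * ‖x - y‖ ≤ ℓ β →
              |torusE G r β L (fun U => dens G r x U * dens G r y U) -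
                  torusE G r β L (dens G r x) * torusE G r β L (dens G r y)| ≤ W / (1 + ‖x - y‖) ^ 8)) :
    Summit.QuantumFields.YangMills.Theses.BalabanLadder.IR :=
  ir_of_typCriterion_formatAtScale_covarianceAF stub_typCriterionUc hsharp

end Route

/-! ## §7 `I♯_SC` BY NAME on the simply connected family, and the route decl through the residual -/
section Sharp

/-- **`SharpOnset.OnsetSharpUKPcSC` (I♯_SC) BY NAME from format-at-scale + envelope + window on the simply connected family.**
For every simply connected compact simple `G` and every `r`: one admissible `(n, ε)` and one scale `ℓ` with the format
at a mesh `≤ B(δ)·ℓ(β)` for every `δ`, the crossover envelope and the asymptotic-freedom window give, for every positive unit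
`a → 0` carrying `LowerBounds G r a` and every `δ > 0`, a mesh `b` with the format AND `a(β)·b < B·T` eventually — the
onset pinned by the witness (`scale_pinned_of_witness`) and `afBelowScale_of_covarianceAF`. [kernel composition; hypotheses OPEN] -/
theorem onsetSharpUKPcSC_of_formatAtScale_covarianceAF
    (hsharp : ∀ (G : Type) [Group G] [TopologicalSpace G] [IsTopologicalGroup G] [CompactSpace G],
      IsCompactSimpleLieGroup G → SimplyConnectedSpace G →
      letI : MeasurableSpace G := borel G; haveI : BorelSpace G := ⟨rfl⟩;
      ∀ r : LatticeRep G, ∃ (n : ℕ) (ε : ℝ), 1 ≤ n ∧ 0 ≤ ε ∧ ε * OnsetFormats.shellCount n ≤ 3 / 4 ∧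
        ∃ ℓ : ℝ → ℝ,
          (∀ δ : ℝ, 0 < δ → ∃ B β₂ : ℝ, 0 < B ∧ ∀ β : ℝ, β₂ ≤ β →
            ∃ b : ℕ, 1 ≤ b ∧ (b : ℝ) ≤ B * ℓ β ∧ TypShellCondUKPc r.ρ β b n ε δ) ∧
          (∃ W₀ β₀ : ℝ, ∀ β : ℝ, β₀ ≤ β → ∀ᶠ L : ℕ in atTop, ∀ x ∈ box 4 L, ∀ y ∈ box 4 L,
            ‖x - y‖ ≤ (L : ℝ) →
              |torusE G r β L (fun U => dens G r x U * dens G r y U) -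
                  torusE G r β L (dens G r x) * torusE G r β L (dens G r y)| ≤ W₀ / (1 + ‖x - y‖) ^ 8) ∧
          (∀ W : ℝ, 0 < W → ∃ T' β₀ : ℝ, 0 < T' ∧ ∀ β : ℝ, β₀ ≤ β → ∀ᶠ L : ℕ in atTop,
            ∀ x ∈ box 4 L, ∀ y ∈ box 4 L, ‖x - y‖ ≤ (L : ℝ) → T' * ‖x - y‖ ≤ ℓ β →
              |torusE G r β L (fun U => dens G r x U * dens G r y U) -
                  torusE G r β L (dens G r x) * torusE G r β L (dens G r y)| ≤ W / (1 + ‖x - y‖) ^ 8)) :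
    SharpOnset.OnsetSharpUKPcSC := by
  intro G _ _ _ _ hG hsc
  letI : MeasurableSpace G := borel G
  haveI : BorelSpace G := ⟨rfl⟩
  intro r a ha _ hlb
  obtain ⟨n, ε, hn, hε, hM, ℓ, hF, henv, haf⟩ := hsharp G hG hsc r
  refine ⟨n, ε, hn, hε, hM, fun δ hδ => ?_⟩
  obtain ⟨⟨v, ε₅, β₅, Λ₅, hv, hε₅, hlow⟩, -⟩ := hlb
  obtain ⟨T, β₁, hT⟩ := afBelowScale_of_covarianceAF r ℓ henv haf v hv (half_pos hε₅)
  have hpinℓ := scale_pinned_of_witness r a ℓ ha hlow hT hε₅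
  obtain ⟨B, β₂, hB, hFβ⟩ := hF δ hδ
  refine ⟨B * T, max (max β₁ β₅) β₂, fun β hβ => ?_⟩
  obtain ⟨b, hb1, hbℓ, hP⟩ := hFβ β (le_trans (le_max_right _ _) hβ)
  refine ⟨b, hb1, ?_, hP⟩
  calc a β * (b : ℝ) ≤ a β * (B * ℓ β) := mul_le_mul_of_nonneg_left hbℓ (ha β).le
    _ = B * (a β * ℓ β) := by ring
    _ < B * T := mul_lt_mul_of_pos_left (hpinℓ β (le_trans (le_max_left _ _) hβ)) hB

/-- **`BalabanLadder.IR` BY NAME, X-free and E-free, through the slot's sharp currency**: the per-`(G, r)` data of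
`onsetSharpUKPcSC_of_formatAtScale_covarianceAF` on the simply connected family and the registered residual `stub_irNSC`-type
hypothesis `SharpOnset.IRNSC` give the route decl (via `SharpOnset.ir_of_onsetSharpSC`, which discharges E by p524017).
[kernel composition; hypotheses OPEN] -/
theorem ir_of_formatAtScale_covarianceAF_of_irNSC
    (hsharp : ∀ (G : Type) [Group G] [TopologicalSpace G] [IsTopologicalGroup G] [CompactSpace G],
      IsCompactSimpleLieGroup G → SimplyConnectedSpace G →
      letI : MeasurableSpace G := borel G; haveI : BorelSpace G := ⟨rfl⟩;
      ∀ r : LatticeRep G, ∃ (n : ℕ) (ε : ℝ), 1 ≤ n ∧ 0 ≤ ε ∧ ε * OnsetFormats.shellCount n ≤ 3 / 4 ∧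
        ∃ ℓ : ℝ → ℝ,
          (∀ δ : ℝ, 0 < δ → ∃ B β₂ : ℝ, 0 < B ∧ ∀ β : ℝ, β₂ ≤ β →
            ∃ b : ℕ, 1 ≤ b ∧ (b : ℝ) ≤ B * ℓ β ∧ TypShellCondUKPc r.ρ β b n ε δ) ∧
          (∃ W₀ β₀ : ℝ, ∀ β : ℝ, β₀ ≤ β → ∀ᶠ L : ℕ in atTop, ∀ x ∈ box 4 L, ∀ y ∈ box 4 L,
            ‖x - y‖ ≤ (L : ℝ) →
              |torusE G r β L (fun U => dens G r x U * dens G r y U) -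
                  torusE G r β L (dens G r x) * torusE G r β L (dens G r y)| ≤ W₀ / (1 + ‖x - y‖) ^ 8) ∧
          (∀ W : ℝ, 0 < W → ∃ T' β₀ : ℝ, 0 < T' ∧ ∀ β : ℝ, β₀ ≤ β → ∀ᶠ L : ℕ in atTop,
            ∀ x ∈ box 4 L, ∀ y ∈ box 4 L, ‖x - y‖ ≤ (L : ℝ) → T' * ‖x - y‖ ≤ ℓ β →
              |torusE G r β L (fun U => dens G r x U * dens G r y U) -
                  torusE G r β L (dens G r x) * torusE G r β L (dens G r y)| ≤ W / (1 + ‖x - y‖) ^ 8))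
    (hN : SharpOnset.IRNSC) : Summit.QuantumFields.YangMills.Theses.BalabanLadder.IR :=
  SharpOnset.ir_of_onsetSharpSC (onsetSharpUKPcSC_of_formatAtScale_covarianceAF hsharp) hN

end Sharp

/-! ## §8 The kill-world hook in covariance clothes

(Appended.)  Contrapositive of `afToOnsetUKPc_of_covarianceAF` (`…XCovCompact` §3) against cdisprove-afonset's hook of
record `not_ksmInf_of_afToOnsetUKPc` (p528589): in the K-SM∞ world the covariance hypotheses cannot both hold at every
parameter — at some `(G, r, n, ε, δ)` the typical-mixing onset `b⋆` outruns the asymptotic-freedom window (the window at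
scale `b⋆` fails for some `W`), or the crossover envelope fails. -/
section KillWorld

/-- **K-SM∞ refutes «envelope ∧ window at the onset scale, everywhere»** (kernel contrapositive; nothing instantiated:
`KSMInf` is neither constructible nor refutable from the tree, owner R100). -/
theorem not_ksmInf_of_covarianceAF
    (henv : ∀ (G : Type) [Group G] [TopologicalSpace G] [IsTopologicalGroup G] [CompactSpace G],
      IsCompactSimpleLieGroup G → letI : MeasurableSpace G := borel G; haveI : BorelSpace G := ⟨rfl⟩;
      ∀ r : LatticeRep G, ∃ W₀ β₀ : ℝ, ∀ β : ℝ, β₀ ≤ β → ∀ᶠ L : ℕ in atTop, ∀ x ∈ box 4 L, ∀ y ∈ box 4 L,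
        ‖x - y‖ ≤ (L : ℝ) →
          |torusE G r β L (fun U => dens G r x U * dens G r y U) -
              torusE G r β L (dens G r x) * torusE G r β L (dens G r y)| ≤ W₀ / (1 + ‖x - y‖) ^ 8)
    (haf : ∀ (G : Type) [Group G] [TopologicalSpace G] [IsTopologicalGroup G] [CompactSpace G],
      IsCompactSimpleLieGroup G → letI : MeasurableSpace G := borel G; haveI : BorelSpace G := ⟨rfl⟩;
      ∀ (r : LatticeRep G) (n : ℕ) (ε : ℝ), 1 ≤ n → 0 ≤ ε → ε * OnsetFormats.shellCount n ≤ 3 / 4 → ∀ δ : ℝ, 0 < δ →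
        ∀ W : ℝ, 0 < W → ∃ T' β₀ : ℝ, 0 < T' ∧ ∀ β : ℝ, β₀ ≤ β → ∀ᶠ L : ℕ in atTop,
          ∀ x ∈ box 4 L, ∀ y ∈ box 4 L, ‖x - y‖ ≤ (L : ℝ) → T' * ‖x - y‖ ≤ (mixOnsetUc r.ρ β n ε δ : ℝ) →
            |torusE G r β L (fun U => dens G r x U * dens G r y U) -
                torusE G r β L (dens G r x) * torusE G r β L (dens G r y)| ≤ W / (1 + ‖x - y‖) ^ 8) :
    ¬ KSMInf :=
  not_ksmInf_of_afToOnsetUKPc (afToOnsetUKPc_of_covarianceAF henv haf)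

end KillWorld

end Summit.QuantumFields.YangMills.Cruxes.IR.AfPincerUc

end
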